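import Summits.ResolutionOfSingularities.ResolutionOfSingularities.Theorems.RadicialJungCleanModelsDoublingRing
import Literature.AlgebraicGeometry.CossartPiltant200819.GoodResolution2019
import Literature.AlgebraicGeometry.Resolution.ExcellentRingsFieldProofs
import Literature.AlgebraicGeometry.Resolution.EtaleVanishingIdeal
import Literature.AlgebraicGeometry.Resolution.RegularLocalRingsProofs
import Literature.AlgebraicGeometry.Resolution.AlterationsResolution
import Literature.AlgebraicGeometry.Motives.GoodReductionSpecialFibreProofs
import Literature.AlgebraicGeometry.Morphisms.SectionEqualizerClopen
import Literature.AlgebraicGeometry.Morphisms.IsoOverOpen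
import Mathlib.AlgebraicGeometry.Morphisms.Finite
import HarnessLib

/-!
# `hEmb` for a hypersurface `V(x) ⊂ Spec R` from Cossart–Piltant 2019 Thm. 1.1 (i)–(iii): the doubling trick

Crux `RadicialJung.CleanModels` (stmt-ResolutionOfSingularities-15917), line `Sketch`, printed stub `stub_cjs2020Thm14`
(F-32 = CJS 2020 Thm. 1.4).  The two places where the dim-3 slice APPLIES F-32 (through `stub_cjs2020Cor15`) are of
the shape `hEmb (Spec R) … (V(x)) …` with `R` an excellent regular local ring of dimension `≤ 3`
(`Literature/…/MonomializationAlongValuation.lean:727`, `Theorems/RadicialJungCleanModelsCleanLU3CompositeMonoDim.lean:92`).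
This file proves that shape from the tree's VERBATIM typing of Cossart–Piltant 2019 Thm. 1.1 WITH conclusion (iii)
(`CP2019.CossartPiltant2019Thm11`, `GoodResolution2019.lean`) — the «doubling trick»: apply Thm. 1.1 to the reduced
threefold `Y = Spec R[t]/(t² − x t)` (two copies of `Spec R` glued along `V(x)`; ring facts in
`RadicialJungCleanModelsDoublingRing.lean`), whose singular locus is exactly `V(t, x) ≅ V(x)`; a good resolution
`π : Y' → Y` is an isomorphism over `Reg Y = Y ∖ V(x)` with `π⁻¹(V(x))` a strict normal crossings divisor; the
clopen piece `W = Y' ∖ closure (π⁻¹(sheet `t = x` ∖ V(x)))` of the regular `Y'` maps properly and birationally onto the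
sheet `t = 0`, i.e. onto `Spec R`, isomorphically over `D(x)`, and `W ∩ π⁻¹(V(x))` is an snc divisor on `W`.

Main result: `hEmb_zeroLocus_of_thm11`.  Consequence for the skeleton (lead's decision): the binder `hEmb` of the two
consumers can be weakened to this local hypersurface shape and then discharged from `CossartPiltant2019Thm11`, so that the
named printed base of the dim-3 slice no longer cites CJS 2020 separately (in substance CP 2019's proof uses CJS 2020).
-/

noncomputable section

-- lint debt: the summit's namespace repeats `ResolutionOfSingularities` (summit = problem), as in every file here.
set_option linter.dupNamespace false

open Polynomial IsLocalRing CategoryTheory AlgebraicGeometry TopologicalSpace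
open Literature.AlgebraicGeometry.Resolution Literature.AlgebraicGeometry.CossartPiltant200819

namespace Summit.ResolutionOfSingularities.ResolutionOfSingularities.Theorems.RadicialJung.CleanModels.Doubling

universe u

variable {R : Type u} [CommRing R] (x : R)

/-! ## The sheet charts `S[1/(t − x)] = R[1/x]` and `S[1/t] = R[1/x]` -/

/-- `S[1/(t − x)]` is the localisation `R[1/x]` (in it `t = 0` and `x = −(t − x)` is a unit). [folklore] -/
theorem isLocalization_away_of_away_root_sub (T : Type u) [CommRing T]
    [Algebra (AdjoinRoot (X ^ 2 - C x * X)) T] [Algebra R T]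
    [IsScalarTower R (AdjoinRoot (X ^ 2 - C x * X)) T]
    [IsLocalization.Away (AdjoinRoot.root (X ^ 2 - C x * X) - AdjoinRoot.of _ x) T] :
    IsLocalization.Away x T := by
  have halg : ∀ r : R, algebraMap R T r = algebraMap (AdjoinRoot (X ^ 2 - C x * X)) T (AdjoinRoot.of _ r) :=
    fun r => by rw [IsScalarTower.algebraMap_apply R (AdjoinRoot (X ^ 2 - C x * X)) T, AdjoinRoot.algebraMap_eq]
  have hu : IsUnit (algebraMap (AdjoinRoot (X ^ 2 - C x * X)) T
      (AdjoinRoot.root (X ^ 2 - C x * X) - AdjoinRoot.of _ x)) :=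
    IsLocalization.Away.algebraMap_isUnit _
  have hroot : algebraMap (AdjoinRoot (X ^ 2 - C x * X)) T (AdjoinRoot.root (X ^ 2 - C x * X)) = 0 := by
    have := congrArg (algebraMap (AdjoinRoot (X ^ 2 - C x * X)) T) (root_mul_root_sub x)
    rw [map_mul, map_zero] at this
    exact (hu.mul_left_eq_zero).mp this
  have hx : algebraMap R T x = -algebraMap (AdjoinRoot (X ^ 2 - C x * X)) T
      (AdjoinRoot.root (X ^ 2 - C x * X) - AdjoinRoot.of _ x) := by
    rw [halg, map_sub, hroot, zero_sub, neg_neg]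
  refine (isLocalization_iff _ _).mpr ⟨?_, ?_, ?_⟩
  · rintro ⟨y, n, rfl⟩
    rw [map_pow, hx, neg_pow]
    exact ((isUnit_one.neg).pow n).mul (hu.pow n)
  · intro z
    obtain ⟨⟨w, ⟨s, n, rfl⟩⟩, hz⟩ :=
      IsLocalization.surj (Submonoid.powers (AdjoinRoot.root (X ^ 2 - C x * X) - AdjoinRoot.of _ x)) z
    obtain ⟨a, b, rfl⟩ := exists_eq_of_add_of_mul_root x w
    refine ⟨⟨(-1) ^ n * a, ⟨x ^ n, n, rfl⟩⟩, ?_⟩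
    simp only at hz ⊢
    rw [map_add, map_mul, hroot, mul_zero, add_zero, map_pow] at hz
    rw [map_pow, hx, neg_pow, map_mul, map_pow, map_neg, map_one, halg a, ← hz]
    ring
  · intro r₁ r₂ h
    rw [halg, halg] at h
    obtain ⟨⟨c, n, rfl⟩, hc⟩ := (IsLocalization.eq_iff_exists
      (Submonoid.powers (AdjoinRoot.root (X ^ 2 - C x * X) - AdjoinRoot.of _ x)) T).mp h
    refine ⟨⟨x ^ n, n, rfl⟩, ?_⟩
    have := congrArg (AdjoinRoot.lift (RingHom.id R) (0 : R) (eval₂_zero x)) hc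
    simp only [map_mul, map_pow, map_sub, AdjoinRoot.lift_root, AdjoinRoot.lift_of, RingHom.id_apply,
      zero_sub] at this
    simp only
    have h2 : (-1 : R) ^ n * (x ^ n * r₁) = (-1) ^ n * (x ^ n * r₂) := by
      rw [← mul_assoc, ← mul_assoc, ← mul_pow, ← neg_eq_neg_one_mul]; exact this
    exact (IsUnit.mul_right_inj ((isUnit_one.neg).pow n)).mp h2


/-! ## The regular locus of `Y = Spec S` -/

/-- **The regular locus of `Y = Spec R[t]/(t² − x t)` is the complement of `V(x)`** (`R` a regular domain,
`x ≠ 0`): off `V(x)` the local rings are local rings of `R`, on `V(x)` they are not domains. [folklore] -/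
theorem isRegularLocalRing_stalk_iff_not_mem [IsDomain R] [IsRegularRing R] (hx : x ≠ 0)
    (P : ↥(Spec (.of (AdjoinRoot (X ^ 2 - C x * X))))) :
    IsRegularLocalRing ((Spec (.of (AdjoinRoot (X ^ 2 - C x * X)))).presheaf.stalk P) ↔
      AdjoinRoot.of _ x ∉ P.asIdeal := by
  let e : (Spec.structureSheaf (AdjoinRoot (X ^ 2 - C x * X))).presheaf.stalk P ≃ₐ[AdjoinRoot (X ^ 2 - C x * X)]
      Localization.AtPrime P.asIdeal :=
    IsLocalization.algEquiv P.asIdeal.primeCompl _ _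
  change IsRegularLocalRing ((Spec.structureSheaf (AdjoinRoot (X ^ 2 - C x * X))).presheaf.stalk P) ↔ _
  constructor
  · intro h hxP
    haveI : IsRegularLocalRing (Localization.AtPrime P.asIdeal) := IsRegularLocalRing.of_ringEquiv e.toRingEquiv
    exact not_isDomain_localization_of_mem x hx P.asIdeal hxP
      (isDomain_of_isRegularLocalRing (R := Localization.AtPrime P.asIdeal))
  · intro h
    haveI := isRegularLocalRing_localization_of_not_mem x P.asIdeal h
    exact IsRegularLocalRing.of_ringEquiv e.toRingEquiv.symm

/-! ## The doubling trick -/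

/-- **`hEmb` for a hypersurface of a regular local threefold from Cossart–Piltant 2019 Thm. 1.1 (i)–(iii).**
For `R` an excellent regular domain (all local rings regular) of Krull dimension `≤ 3` and `0 ≠ x ∈ R`, the typed
printed theorem `CP2019.CossartPiltant2019Thm11` yields a proper surjective `π : Z' → Spec R`, an isomorphism over
`D(x)`, with `π⁻¹(V(x))` a strict normal crossings divisor on `Z'` — exactly the shape in which the dim-3 slice of
`CleanModels` consumes CJS 2020 Cor. 1.5.  Proof: the doubling trick (module docstring).
[cite: CossartPiltant2019, Thm. 1.1] -/
theorem hEmb_zeroLocus_of_thm11 (h11 : CP2019.CossartPiltant2019Thm11.{u})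
    (R : Type u) [CommRing R] [IsDomain R] [IsRegularRing R] (hexc : IsExcellentRing R)
    (hdim : ringKrullDim R ≤ 3) (x : R) (hx : x ≠ 0) :
    ∃ (Z' : Scheme.{u}) (π : Z' ⟶ Spec (.of R)), IsProper π ∧ Function.Surjective π.base ∧
      (∃ U : (Spec (.of R)).Opens,
        (U : Set ↥(Spec (.of R))) = (PrimeSpectrum.zeroLocus ({x} : Set R) : Set (PrimeSpectrum R))ᶜ ∧
        IsIso (π ∣_ U)) ∧
      IsStrictNormalCrossingsDivisor Z'
        (π.base ⁻¹' (PrimeSpectrum.zeroLocus ({x} : Set R) : Set (PrimeSpectrum R))) := by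
  classical
  -- the doubled ring `S = R[t]/(t² - x t)` and `Y = Spec S → Spec R`
  haveI hSred : _root_.IsReduced (AdjoinRoot (X ^ 2 - C x * X)) := isReduced x hx
  have hSexc : IsExcellentRing (AdjoinRoot (X ^ 2 - C x * X)) := isExcellentRing x hexc
  have hSdim : ringKrullDim (AdjoinRoot (X ^ 2 - C x * X)) ≤ 3 := (ringKrullDim_eq x).trans_le hdim
  haveI : IsNoetherianRing (AdjoinRoot (X ^ 2 - C x * X)) := hSexc.isQuasiExcellentRing.isNoetherianRing
  -- CP 2019 Thm 1.1 (i)(ii)(iii) for `Y`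
  obtain ⟨Y', π, hgood⟩ := CP2019.CossartPiltant2019Thm11.hasGoodResolution_spec h11 Stacks07QU_holds
    (AdjoinRoot (X ^ 2 - C x * X)) hSexc.isQuasiExcellentRing hSdim
  obtain ⟨⟨hproper, hbir, hY'reg⟩, ⟨U, hU, hUiso⟩, hsnc⟩ := hgood
  haveI := hproper
  haveI := hUiso
  haveI : IsLocallyNoetherian Y' := LocallyOfFiniteType.isLocallyNoetherian π
  -- the structure map `q : Y → Spec R` (finite)
  haveI hfinS : Module.Finite R (AdjoinRoot (X ^ 2 - C x * X)) := moduleFinite x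
  haveI : IsFinite (Spec.map (CommRingCat.ofHom (algebraMap R (AdjoinRoot (X ^ 2 - C x * X))))) := by
    rw [IsFinite.SpecMap_iff, CommRingCat.hom_ofHom]
    exact RingHom.finite_algebraMap.mpr hfinS
  -- the regular locus of `Y` is the complement of `V(x)`
  have hreg : ∀ P : ↥(Spec (.of (AdjoinRoot (X ^ 2 - C x * X)))),
      P ∈ Scheme.regularLocus (Spec (.of (AdjoinRoot (X ^ 2 - C x * X)))) ↔ AdjoinRoot.of _ x ∉ P.asIdeal :=
    fun P => isRegularLocalRing_stalk_iff_not_mem x hx P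
  -- the chart `t - x ≠ 0` (sheet `t = 0` off `V(x)`) as the range of `Spec S[1/(t - x)] → Y`
  obtain ⟨ι₀, hι₀⟩ : ∃ ι₀ : Spec (.of (Localization.Away (AdjoinRoot.root (X ^ 2 - C x * X) - AdjoinRoot.of _ x))) ⟶
      Spec (.of (AdjoinRoot (X ^ 2 - C x * X))), ι₀ = Spec.map (CommRingCat.ofHom (algebraMap _ _)) := ⟨_, rfl⟩
  haveI hι₀oi : IsOpenImmersion ι₀ := by rw [hι₀]; infer_instance
  have hO₀ : ∀ P, P ∈ ι₀.opensRange ↔ AdjoinRoot.root (X ^ 2 - C x * X) - AdjoinRoot.of _ x ∉ P.asIdeal := by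
    intro P
    have h := PrimeSpectrum.localization_away_comap_range
      (Localization.Away (AdjoinRoot.root (X ^ 2 - C x * X) - AdjoinRoot.of _ x))
      (AdjoinRoot.root (X ^ 2 - C x * X) - AdjoinRoot.of _ x)
    have h' : Set.range ι₀.base = Set.range (PrimeSpectrum.comap (algebraMap (AdjoinRoot (X ^ 2 - C x * X))
        (Localization.Away (AdjoinRoot.root (X ^ 2 - C x * X) - AdjoinRoot.of _ x)))) := by
      rw [hι₀]; rfl
    change P ∈ (ι₀.opensRange : Set _) ↔ _
    rw [Scheme.Hom.coe_opensRange, h', h]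
    rfl
  have hO₀U : ι₀.opensRange ≤ U := by
    intro P hP
    rw [← SetLike.mem_coe, hU]
    exact (hreg P).mpr fun hxP => (hO₀ P).mp hP (root_mem_of_mem x P.asIdeal hxP).2
  haveI hisoO₀ : IsIso (π ∣_ ι₀.opensRange) :=
    Literature.AlgebraicGeometry.Morphisms.isIso_morphismRestrict_of_le π hO₀U
  -- the chart `t ≠ 0` of `Y` (sheet `t = x` off `V(x)`) and its preimage `V₁`
  obtain ⟨O₁, hO₁⟩ : ∃ O₁ : (Spec (.of (AdjoinRoot (X ^ 2 - C x * X)))).Opens,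
      ∀ P, P ∈ O₁ ↔ AdjoinRoot.root (X ^ 2 - C x * X) ∉ P.asIdeal :=
    ⟨⟨{P | AdjoinRoot.root (X ^ 2 - C x * X) ∉ P.asIdeal}, (PrimeSpectrum.basicOpen _).isOpen⟩, fun P => Iff.rfl⟩
  have hO₀O₁ : ∀ P, P ∈ ι₀.opensRange → P ∈ O₁ → False := by
    intro P h0 h1
    rw [hO₀] at h0
    rw [hO₁] at h1
    rcases P.isPrime.mem_or_mem ((root_mul_root_sub x).symm ▸ P.asIdeal.zero_mem :
      AdjoinRoot.root (X ^ 2 - C x * X) * (AdjoinRoot.root (X ^ 2 - C x * X) - AdjoinRoot.of _ x) ∈ P.asIdeal)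
      with h | h
    · exact h1 h
    · exact h0 h
  have hO₀O₁' : ∀ P : ↥(Spec (.of (AdjoinRoot (X ^ 2 - C x * X)))), AdjoinRoot.of _ x ∉ P.asIdeal →
      P ∈ ι₀.opensRange ∨ P ∈ O₁ := by
    intro P hP
    rw [hO₀, hO₁]
    rcases root_mem_or_of_not_mem x P.asIdeal hP with ⟨-, h⟩ | ⟨h, -⟩
    · exact Or.inl h
    · exact Or.inr h
  -- `W = Y' ∖ closure (π⁻¹ O₁)` is clopen (the component of `Y'` over the sheet `t = 0`)
  have hclopen : IsOpen (closure ((π ⁻¹ᵁ O₁ : Y'.Opens) : Set Y')) := by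
    rw [isOpen_iff_forall_mem_open]
    intro y hy
    haveI := hY'reg y
    haveI : IsDomain (Y'.presheaf.stalk y) := isDomain_of_isRegularLocalRing (R := Y'.presheaf.stalk y)
    obtain ⟨N, hNo, hyN, hNirr⟩ :=
      Literature.AlgebraicGeometry.Motives.exists_isOpen_isIrreducible_of_isDomain_stalk Y' y
    refine ⟨N, fun z hz => ?_, hNo, hyN⟩
    have hne : (N ∩ ((π ⁻¹ᵁ O₁ : Y'.Opens) : Set Y')).Nonempty := mem_closure_iff.mp hy N hNo hyN
    rw [mem_closure_iff]
    intro o ho hzo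
    obtain ⟨w, -, hwo, hwV⟩ := hNirr.isPreirreducible o _ ho (π ⁻¹ᵁ O₁).isOpen ⟨z, hz, hzo⟩ hne
    exact ⟨w, hwo, hwV⟩
  obtain ⟨W, hW⟩ : ∃ W : Y'.Opens, (W : Set Y') = (closure ((π ⁻¹ᵁ O₁ : Y'.Opens) : Set Y'))ᶜ :=
    ⟨⟨_, isClosed_closure.isOpen_compl⟩, rfl⟩
  have hWmem : ∀ y, y ∈ W ↔ y ∉ closure ((π ⁻¹ᵁ O₁ : Y'.Opens) : Set Y') := fun y => by
    rw [← SetLike.mem_coe, hW]; rfl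
  have hWclosed : IsClosed (W : Set Y') := by rw [hW]; exact hclopen.isClosed_compl
  haveI : IsClosedImmersion W.ι := Literature.AlgebraicGeometry.Morphisms.isClosedImmersion_ι_of_isClosed W hWclosed
  have hV₀W : π ⁻¹ᵁ ι₀.opensRange ≤ W := by
    have hdisj : Disjoint ((π ⁻¹ᵁ ι₀.opensRange : Y'.Opens) : Set Y') ((π ⁻¹ᵁ O₁ : Y'.Opens) : Set Y') := by
      rw [Set.disjoint_left]
      intro z hz0 hz1
      exact hO₀O₁ (π.base z) hz0 hz1
    intro y hy
    rw [hWmem]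
    exact Set.disjoint_left.mp (hdisj.closure_right (π ⁻¹ᵁ ι₀.opensRange).isOpen) hy
  have hWV₁ : ∀ y, y ∈ W → π.base y ∉ O₁ := by
    intro y hy h1
    exact (hWmem y).mp hy (subset_closure h1)
  -- `π` is surjective (proper and birational)
  have hπsurj : Function.Surjective π.base := by
    have hd : DenseRange π.base := hbir.isDominant.denseRange
    have hc : IsClosed (Set.range π.base) := π.isClosedMap.isClosed_range
    rw [← Set.range_eq_univ, ← hc.closure_eq, hd.closure_range]
  -- the sheet `t = 0`: `j₀ : Spec R → Y`, a section of `q`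
  obtain ⟨j₀, hj₀⟩ : ∃ j₀ : Spec (.of R) ⟶ Spec (.of (AdjoinRoot (X ^ 2 - C x * X))),
      j₀ = Spec.map (CommRingCat.ofHom (AdjoinRoot.lift (RingHom.id R) (0 : R) (eval₂_zero x))) := ⟨_, rfl⟩
  have hj₀asIdeal : ∀ p : ↥(Spec (.of R)), (j₀.base p).asIdeal =
      p.asIdeal.comap (AdjoinRoot.lift (RingHom.id R) (0 : R) (eval₂_zero x)) := by
    intro p; rw [hj₀]; rfl
  have hqasIdeal : ∀ P : ↥(Spec (.of (AdjoinRoot (X ^ 2 - C x * X)))),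
      ((Spec.map (CommRingCat.ofHom (algebraMap R (AdjoinRoot (X ^ 2 - C x * X))))).base P).asIdeal =
        P.asIdeal.comap (algebraMap R (AdjoinRoot (X ^ 2 - C x * X))) := fun P => rfl
  have hqj₀ : ∀ p : ↥(Spec (.of R)),
      (Spec.map (CommRingCat.ofHom (algebraMap R (AdjoinRoot (X ^ 2 - C x * X))))).base (j₀.base p) = p := by
    intro p
    apply PrimeSpectrum.ext
    rw [hqasIdeal, hj₀asIdeal, Ideal.comap_comap]
    ext r
    rw [Ideal.mem_comap]
    simp [AdjoinRoot.algebraMap_eq]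
  have hj₀O₀ : ∀ p : ↥(Spec (.of R)), x ∉ p.asIdeal → j₀.base p ∈ ι₀.opensRange := by
    intro p hp
    rw [hO₀, hj₀asIdeal, Ideal.mem_comap]
    simpa [AdjoinRoot.lift_root, AdjoinRoot.lift_of] using hp
  -- surjectivity of `π₀ = W.ι ≫ π ≫ q`
  have himgW : ∀ p : ↥(Spec (.of R)), ∃ y : Y', y ∈ W ∧ π.base y = j₀.base p := by
    intro p
    have hWimg_closed : IsClosed (π.base '' (W : Set Y')) := π.isClosedMap _ hWclosed
    have hO₀sub : (ι₀.opensRange : Set _) ⊆ π.base '' (W : Set Y') := by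
      intro P hP
      obtain ⟨y, hy⟩ := hπsurj P
      exact ⟨y, hV₀W (show π.base y ∈ ι₀.opensRange from hy ▸ hP), hy⟩
    have hDx : Dense ((PrimeSpectrum.basicOpen x : Opens (PrimeSpectrum R)) : Set (PrimeSpectrum R)) := by
      refine (PrimeSpectrum.basicOpen x).isOpen.dense ⟨⟨⊥, Ideal.isPrime_bot⟩, ?_⟩
      simpa using hx
    have hsub : ((PrimeSpectrum.basicOpen x : Opens (PrimeSpectrum R)) : Set (PrimeSpectrum R)) ⊆
        j₀.base ⁻¹' (ι₀.opensRange : Set _) := fun p' hp' => hj₀O₀ p' hp'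
    have hcl : j₀.base p ∈ closure (ι₀.opensRange : Set _) := by
      have hp : (p : PrimeSpectrum R) ∈ closure ((PrimeSpectrum.basicOpen x : Opens (PrimeSpectrum R)) :
          Set (PrimeSpectrum R)) := hDx p
      have := image_closure_subset_closure_image j₀.base.hom.continuous ⟨p, hp, rfl⟩
      exact closure_mono (Set.image_subset_iff.mpr hsub) this
    have hmem : j₀.base p ∈ π.base '' (W : Set Y') := (hWimg_closed.closure_subset_iff.mpr hO₀sub) hcl
    obtain ⟨y, hyW, hy⟩ := hmem
    exact ⟨y, hyW, hy⟩
  have hπ₀surj : Function.Surjective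
      (W.ι ≫ π ≫ Spec.map (CommRingCat.ofHom (algebraMap R (AdjoinRoot (X ^ 2 - C x * X))))).base := by
    intro p
    obtain ⟨y, hyW, hy⟩ := himgW p
    refine ⟨⟨y, hyW⟩, ?_⟩
    change (Spec.map (CommRingCat.ofHom (algebraMap R (AdjoinRoot (X ^ 2 - C x * X))))).base (π.base y) = p
    rw [hy, hqj₀]
  -- the open `D(x) ⊆ Spec R`
  obtain ⟨Ux, hUx⟩ : ∃ Ux : (Spec (.of R)).Opens, ∀ p, p ∈ Ux ↔ x ∉ p.asIdeal :=
    ⟨⟨{p | x ∉ p.asIdeal}, (PrimeSpectrum.basicOpen x).isOpen⟩, fun p => Iff.rfl⟩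
  -- points of `W` over `D(x)` are exactly the points of `π⁻¹ O₀`
  have hpre : ∀ w : ↥W, w ∈ (W.ι ≫ π ≫ Spec.map (CommRingCat.ofHom (algebraMap R (AdjoinRoot (X ^ 2 - C x * X))))) ⁻¹ᵁ Ux
      ↔ π.base w.1 ∈ ι₀.opensRange := by
    intro w
    change (Spec.map (CommRingCat.ofHom (algebraMap R (AdjoinRoot (X ^ 2 - C x * X))))).base (π.base w.1) ∈ Ux ↔ _
    rw [hUx, hqasIdeal, Ideal.mem_comap, AdjoinRoot.algebraMap_eq]
    constructor
    · intro hx'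
      rcases hO₀O₁' _ hx' with h | h
      · exact h
      · exact absurd h (hWV₁ w.1 w.2)
    · intro h hx'
      rw [hO₀] at h
      exact h (root_mem_of_mem x _ hx').2
  refine ⟨W, W.ι ≫ π ≫ Spec.map (CommRingCat.ofHom (algebraMap R (AdjoinRoot (X ^ 2 - C x * X)))), inferInstance,
    hπ₀surj, ⟨Ux, ?_, ?_⟩, ?_⟩
  · -- `Ux = D(x)`
    ext p
    rw [SetLike.mem_coe, hUx]
    change _ ↔ ¬ (({x} : Set R) ⊆ p.asIdeal)
    rw [Set.singleton_subset_iff]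
    rfl
  · -- `π₀` is an isomorphism over `D(x)`: an open immersion (it is `π⁻¹ O₀ ≅ O₀ ≅ Spec R[1/x] ⊆ Spec R`) and surjective
    have hrange : Set.range (((W.ι ≫ π ≫ Spec.map (CommRingCat.ofHom (algebraMap R (AdjoinRoot (X ^ 2 - C x * X))))) ⁻¹ᵁ
        Ux).ι ≫ W.ι).base = Set.range (π ⁻¹ᵁ ι₀.opensRange).ι.base := by
      rw [Scheme.Opens.range_ι]
      ext y
      constructor
      · rintro ⟨w, rfl⟩
        exact (hpre w.1).mp w.2
      · intro hy
        exact ⟨⟨⟨y, hV₀W hy⟩, (hpre ⟨y, hV₀W hy⟩).mpr hy⟩, rfl⟩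
    haveI : IsOpenImmersion (((W.ι ≫ π ≫ Spec.map (CommRingCat.ofHom (algebraMap R (AdjoinRoot (X ^ 2 - C x * X))))) ⁻¹ᵁ
        Ux).ι ≫ (W.ι ≫ π ≫ Spec.map (CommRingCat.ofHom (algebraMap R (AdjoinRoot (X ^ 2 - C x * X)))))) := by
      have h1 : ((W.ι ≫ π ≫ Spec.map (CommRingCat.ofHom (algebraMap R (AdjoinRoot (X ^ 2 - C x * X))))) ⁻¹ᵁ Ux).ι ≫ W.ι
          = (IsOpenImmersion.isoOfRangeEq _ _ hrange).hom ≫ (π ⁻¹ᵁ ι₀.opensRange).ι :=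
        (IsOpenImmersion.isoOfRangeEq_hom_fac _ _ hrange).symm
      have h2 : (π ⁻¹ᵁ ι₀.opensRange).ι ≫ π = (π ∣_ ι₀.opensRange) ≫ ι₀.opensRange.ι :=
        (morphismRestrict_ι _ _).symm
      have h3 : ι₀.opensRange.ι = ι₀.isoOpensRange.inv ≫ ι₀ := by
        rw [Iso.eq_inv_comp, Scheme.Hom.isoOpensRange_hom_ι]
      have hfac : ((W.ι ≫ π ≫ Spec.map (CommRingCat.ofHom (algebraMap R (AdjoinRoot (X ^ 2 - C x * X))))) ⁻¹ᵁ Ux).ι ≫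
          (W.ι ≫ π ≫ Spec.map (CommRingCat.ofHom (algebraMap R (AdjoinRoot (X ^ 2 - C x * X))))) =
          (IsOpenImmersion.isoOfRangeEq _ _ hrange).hom ≫ (π ∣_ ι₀.opensRange) ≫ ι₀.isoOpensRange.inv ≫ ι₀ ≫
            Spec.map (CommRingCat.ofHom (algebraMap R (AdjoinRoot (X ^ 2 - C x * X)))) :=
        calc ((W.ι ≫ π ≫ Spec.map (CommRingCat.ofHom (algebraMap R (AdjoinRoot (X ^ 2 - C x * X))))) ⁻¹ᵁ Ux).ι ≫
              (W.ι ≫ π ≫ Spec.map (CommRingCat.ofHom (algebraMap R (AdjoinRoot (X ^ 2 - C x * X)))))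
            = (((W.ι ≫ π ≫ Spec.map (CommRingCat.ofHom (algebraMap R (AdjoinRoot (X ^ 2 - C x * X))))) ⁻¹ᵁ Ux).ι ≫
                W.ι) ≫ π ≫ Spec.map (CommRingCat.ofHom (algebraMap R (AdjoinRoot (X ^ 2 - C x * X)))) := by
              simp only [Category.assoc]
          _ = ((IsOpenImmersion.isoOfRangeEq _ _ hrange).hom ≫ (π ⁻¹ᵁ ι₀.opensRange).ι) ≫ π ≫
                Spec.map (CommRingCat.ofHom (algebraMap R (AdjoinRoot (X ^ 2 - C x * X)))) :=
              congrArg (· ≫ π ≫ Spec.map (CommRingCat.ofHom (algebraMap R (AdjoinRoot (X ^ 2 - C x * X))))) h1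
          _ = (IsOpenImmersion.isoOfRangeEq _ _ hrange).hom ≫ ((π ⁻¹ᵁ ι₀.opensRange).ι ≫ π) ≫
                Spec.map (CommRingCat.ofHom (algebraMap R (AdjoinRoot (X ^ 2 - C x * X)))) := by
              simp only [Category.assoc]
          _ = (IsOpenImmersion.isoOfRangeEq _ _ hrange).hom ≫ ((π ∣_ ι₀.opensRange) ≫ ι₀.opensRange.ι) ≫
                Spec.map (CommRingCat.ofHom (algebraMap R (AdjoinRoot (X ^ 2 - C x * X)))) := by rw [h2]
          _ = _ := by rw [h3]; simp only [Category.assoc]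
      rw [hfac]
      haveI : IsOpenImmersion (ι₀ ≫ Spec.map (CommRingCat.ofHom (algebraMap R (AdjoinRoot (X ^ 2 - C x * X))))) := by
        have : ι₀ ≫ Spec.map (CommRingCat.ofHom (algebraMap R (AdjoinRoot (X ^ 2 - C x * X)))) =
            Spec.map (CommRingCat.ofHom (algebraMap R
              (Localization.Away (AdjoinRoot.root (X ^ 2 - C x * X) - AdjoinRoot.of _ x)))) := by
          rw [hι₀, ← Spec.map_comp, ← CommRingCat.ofHom_comp, ← IsScalarTower.algebraMap_eq]
        rw [this]
        haveI := isLocalization_away_of_away_root_sub x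
          (Localization.Away (AdjoinRoot.root (X ^ 2 - C x * X) - AdjoinRoot.of _ x))
        exact IsOpenImmersion.of_isLocalization x
      infer_instance
    haveI : IsOpenImmersion (((W.ι ≫ π ≫ Spec.map (CommRingCat.ofHom (algebraMap R (AdjoinRoot (X ^ 2 - C x * X))))) ∣_ Ux)
        ≫ Ux.ι) := by
      rw [morphismRestrict_ι]; infer_instance
    haveI : IsOpenImmersion ((W.ι ≫ π ≫ Spec.map (CommRingCat.ofHom (algebraMap R (AdjoinRoot (X ^ 2 - C x * X))))) ∣_ Ux) :=
      IsOpenImmersion.of_comp _ Ux.ι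
    refine (isIso_iff_isOpenImmersion_and_surjective _).mpr ⟨inferInstance, ⟨?_⟩⟩
    rintro ⟨p, hp⟩
    have hxp : x ∉ p.asIdeal := (hUx p).mp hp
    obtain ⟨y, hy⟩ := hπsurj (j₀.base p)
    have hy0 : y ∈ π ⁻¹ᵁ ι₀.opensRange := show π.base y ∈ _ from hy ▸ hj₀O₀ p hxp
    have hyW : y ∈ W := hV₀W hy0
    refine ⟨⟨⟨y, hyW⟩, (hpre ⟨y, hyW⟩).mpr (hy ▸ hj₀O₀ p hxp)⟩, ?_⟩
    apply Subtype.ext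
    rw [morphismRestrict_base_coe]
    change (Spec.map (CommRingCat.ofHom (algebraMap R (AdjoinRoot (X ^ 2 - C x * X))))).base (π.base y) = p
    rw [hy, hqj₀]
  · -- the total transform of `V(x)` is the snc divisor `π⁻¹(Sing Y)` restricted to the clopen `W`
    have hsnc' := hsnc.preimage_of_etale W.ι
    convert hsnc' using 1
    ext w
    rw [Set.mem_preimage, Set.mem_preimage, Set.mem_preimage, Set.mem_compl_iff]
    change ({x} : Set R) ⊆ ((Spec.map (CommRingCat.ofHom (algebraMap R (AdjoinRoot (X ^ 2 - C x * X))))).base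
        (π.base (W.ι.base w))).asIdeal ↔ ¬ (π.base (W.ι.base w) ∈ Scheme.regularLocus _)
    rw [hreg, not_not, Set.singleton_subset_iff, SetLike.mem_coe, hqasIdeal, Ideal.mem_comap,
      AdjoinRoot.algebraMap_eq]
end Summit.ResolutionOfSingularities.ResolutionOfSingularities.Theorems.RadicialJung.CleanModels.Doubling

end
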